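import Literature.MathematicalPhysics.QuantumFieldTheory.Balaban1983to89.B9Eq3132DecayFromMajorant
import Literature.MathematicalPhysics.QuantumFieldTheory.Balaban1983to89.B9Eq3132CoerciveFromEnergy
import Literature.MathematicalPhysics.QuantumFieldTheory.Balaban1983to89.B9Eq3132TentLassos

/-!
# `Balaban1983to89.B9Eq3132FacesAtLetters` — T. Bałaban, *Propagators for lattice gauge theories in a background field*, Commun. Math. Phys. **99** (1985)
# 389–434 [Balaban1985BackgroundPropagators], (3.132) p. 422 under Theorem 3.12's prefix p. 423: THE THREE ROW-26 KNIT FACES OF THE N06 CERTIFICATE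
# (`hdec26 ∧ hdec₁26`, `hco26 ∧ hco₁26`, the display face `s3132`) STATED FOR ARBITRARY SECT.-D PROPAGATOR LETTERS `T = G_D(U)`, `T₁ = G₁(U)` AND AN
# ARBITRARY LETTERS FAMILY `𝔏` BEHIND THE `ν`-INSTANCE — so that the certificate can pin Sect. D to the print-units site propagator `η²·G′` (node00-def-Y
# WORD-UNITS-D1) without touching row 26's derivation

[4] = T. Bałaban, *Propagators and renormalization transformations for lattice gauge theories. II*, Commun. Math. Phys. **96** (1984) 223–250 [`Balaban1984PropagatorsII`].

statement-level skeleton of published theorems with citation tags; proofs where landed; nothing here is a claim about the Yang–Mills mass gap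

THE PRINT.  [B9] p. 422: *«The operators (QG̃Q*)⁻¹, or (QG₁Q*)⁻¹, can be analyzed in the same way as the operator (Q′G′²Q′*)⁻¹ in the proof of Theorem 3.2, and we get
|(QG̃Q*)⁻¹(U; y, y′)|, |(QG₁Q*)⁻¹(U; y, y′)| ≦ O(1)(Lʲη)⁻²(L^{j′}η)^{−d} exp(−δ d(y, y′)) (3.132)»*; p. 419 (3.119) *«Δ_π(U) … obtained by gauge transforming A to the
subspace {A : RD*A = 0}»*, i.e. the projector `A − D_U G′(U) R(U) D*_U A` with `G′(U)` THE PRINT's (η-units) site propagator; p. 423 Theorem 3.12 (prefix (3.35), (3.36)).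

WHY THIS FILE (dag-n06-i gen 18, N06 bundle F4, row 26; answer to dag-n06-l LOCATED-UNITS-D1 and node00-def-Y WORD-UNITS-D1 (W1), 2026-08-27).  The three row-26
knit faces of the certificate of record (`B9Eq3132DecayFromMajorant.hdec26_of_step12`, `B9Eq3132CoerciveFromEnergy.hco26_of_energy_step12`,
`B9Eq3132NuReading.s3132Nu_opsYNuOfRecordV4E`) are PINNED to the v4 record's Sect.-D letters `(lettersYOfRecordV4 …).GD ∕ .G₁` — the composites
`GDY ∕ G1Y` of `B9Eq3132SectDLetters` ∕ `Node00.OpsYSectDE` fed the LATTICE-units site propagator `GpY`.  def-Y's WORD-UNITS-D1 re-feeds the Sect.-D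
composites with the print-units propagator `U ↦ η² • GpY … U` (the projector of (3.119) is unit-consistent only then; `R(U)`, `Δ_a(U)`, `G_A(U)` and every
Sect. A–C pin are unaffected — `R` is degree-0 homogeneous in `G′`).  At curved `U` these are DIFFERENT operators, so no rewrite carries the v4-pinned faces to the
re-fed pins.  But every proof underneath is already letter-generic (`majorants_of_step12`, `subMajorants_of_step12`, `coerciveUnder_of_subMajorants`,
`decayUnder_QGQOfY_of_majorants`, `stmt3132Printed_nu_of_coercive_decay`): this file states the faces ONCE for arbitrary letters, so the next edition
instantiates them at whatever record the instance owner lands (`T := fun x => (𝔏 x).GD`, `T₁ := fun x => (𝔏 x).G₁`, pins by `rfl`), and today's faces are the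
instances `𝔏 := lettersYOfRecordV4 …` (folder probe, `rfl` pins).

WHAT IS PROVED (sorry-free; bookkeeping over landed objects; `𝔸 = M_N(ℂ)`, `G = SU(N)`, the record geometry `geo9Y`, transporters `parSymY ∕ parBY`).
* §1 ★★ `s3132Nu_opsYSectE_of_ringInverse (𝔏 𝔈 𝔢 𝔴) (S S₁) (hS hS₁)` — `B9.Stmt3132Printed` for the `ν`-instance `opsYSectE … (opsYS349NuOfLetters … 𝔏 𝔈) 𝔏 𝔢 𝔴`
  over ANY letters family whose `(QGQ*)⁻¹ ∕ (QG₁Q*)⁻¹` fields are the ring inverses of `S`, `S₁`, from the four Λ-normalised Combes–Thomas binders.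
* §2 the shared binders (section variables): letters `T T₁ T₀`, `hT₀ : T₀ x U = Ring.inverse (Δ_a(U))`, row 20's walk model `𝔬` at coordinate pins naming them,
  its displayed inputs `hmodel`, the faithful block map, the neighbour count, row 17's `hΔA`, the tent-energy bound `hP1`.
* §3 `hdec26_of_majorants_of`, ★ `hdec26_of_step12_of` — the two `DecayUnder` binders for `normMatY b Λ⁻¹ (Q_U T(U) Q*_U)` and `(… T₁ …)` from row 20's
  displayed inputs (Theorem 3.3 for `G₀`, the (3.131)∕(3.137) steps, `FormSmall`, `Identities`) at coordinate pins naming `T`, `T₁`.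
* §4 ★ `hco26_of_hcoA_step12_of` (the two `CoerciveUnder` binders from one for `Q T₀ Q*` + the same inputs + the pin `G0 = GcoK … T₀`),
  `hcoA_of_energy_of` (row 17's `hΔA` + `hP1`, verbatim — Sect. A–C stay on `GpY`), ★★ `hco26_of_energy_step12_of`, ★★ `hco26_of_reg335_step12_of` (`hP1`
  discharged by `B9Eq3132TentLassos.hP1_of_reg335`: displays row 17's `hΔA` only).
* §5 ★★★ `s3132Nu_opsYSectE_of_step12` — §3 + §4 + §1: row 26 at such an instance from row 20's inputs and row 17's `hΔA` alone, ONE call.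

CONSUMER NOTE (dag-n06-d, editions ≥ 21; node00-def-Y).  With `𝔏⁺` the next letters record (Sect.-D fields fed `U ↦ η² • GpY … U`, `.GA` unchanged) and the
certificate's instance `opsYSectE N θ M⋆ (opsYS349NuOfLetters N θ M⋆ 𝔏⁺ 𝔈) 𝔏⁺ 𝔢 𝔴` (today `opsYNuOfRecordV4E N θ M⋆ 𝔯 𝔢 𝔴 𝔈` IS this at `𝔏⁺ := lettersYOfRecordV4 … 𝔯`,
`rfl`), with the pins phrased `(𝔬12 x).G U = GcoK … (𝔏⁺ x).GD U` ∕ `.G₁` ∕ `.GA`: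
`s3132 := s3132Nu_opsYSectE_of_step12 θ' M⋆ 𝔯 bK 𝔬12 H12 (fun x => (𝔏⁺ x).GD) (fun x => (𝔏⁺ x).G₁) (fun x => (𝔏⁺ x).GA) (fun _ _ => rfl) hblk12 hGco12 hG1co12
hG0co12 hlev hβ1 hnbr θ12 r12 B12₀ δ12₀ δK12 σ12 ρ12 a12 M12 hθ12 hB12₀ hσ12 hρ12 hρS12 hρδ12 ha12 hM12 hgeoOK hmodel12 a311 M311 ha311 hM311 hΔA 𝔏⁺ 𝔈 𝔢 𝔴
(fun _ => rfl) (fun _ => rfl)` — checked at `𝔏⁺ := lettersYOfRecordV4 …` against edition 20's binder shapes in the author's probe (rc 0).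

HONEST SCOPE.  A bookkeeping generalisation of landed theorems; nothing of [B9] or [4] is asserted; WHICH propagator the certificate pins is the edition's and
the instance owner's business; Theorem 3.3 for `G₀`, the steps, the identities and Theorem 3.11's `hΔA` remain displayed hypotheses of printed shape where the
certificate displays them.  COUNT-NEUTRAL; N06 NOT discharged; one finite 𝕋^{d+1} programme at fixed ε — nothing continuum, nothing OS, nothing about the
mass gap.  Cell `pub-ymgap` (HUMAN RULING D-0062), Track A node N06 [B9], seat `pub-ymgap-dag-n06-i` (gen 18), 2026-08-27; a NEW file.
-/

noncomputable section

namespace Literature.MathematicalPhysics.QuantumFieldTheory.Balaban1983to89.B9Eq3132FacesAtLetters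

open Node00
open B6RandomWalk (HasMajorant)
open B6GlobalChartV1 (blkV1)
open B6Ineq2142KLevelV1 (lvl β)
open B9Thm34Ext (toB6)
open B9Thm312Whole (Ops Thm33G0 Step FormSmall Identities GeoOK)
open B9PinMembersKLevelV1 (MemberY geo9Y bg9Y)
open B7Prop2SpecialUnitary (specialUnitaryUnits specialUnitaryUnits_le_unitaryUnits)
open B9Ineq349SiteFromConv342 (contractive_of_mem)
open B9CoReadingCoords (XBK blkBK GcoK)
open B9CoReadingCoordsTranspose (TrIdx trBasis)
open B9Thm311ReadingCoords (trIP PosDefTr)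
open B9RWSumsReadsNbr (nbr)
open B9Eq3132RingInverseReading (normMatY)
open B9Eq3132NuReading (lamInvY nuY siteKernelOfOpNu opsYS349NuOfLetters stmt3132Printed_nu_of_coercive_decay)
open B9Eq3132CTInputs (CoerciveUnder DecayUnder)
open B9Eq3132ScalarIndex (geoComap)
open B9Eq3132TentOperator (tentOp)
open B9Eq3132ApproxRightInverse (bumpProfile)
open B9Eq3132StepDifference (subMajorants_of_step12)
open B9Eq3132CoerciveFromGA (coerciveUnder_of_subMajorants)
open B9Eq3132DecayFromMajorant (majorants_of_step12 decayUnder_QGQOfY_of_majorants)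
open B9Eq3132CoerciveFromEnergy (hcoA_of_energy)
open B9Eq3132TentLassos (hP1_of_reg335)
open scoped Matrix.Norms.L2Operator

variable {κ : Type} [Fintype κ] [DecidableEq κ] {Ff : Type} [Fintype Ff] [DecidableEq Ff] {N : ℕ}

/-! ## §1 ★★ ROW 26's DISPLAY FACE AT THE `ν`-INSTANCE OVER AN ARBITRARY LETTERS FAMILY -/

section NuFace

/-- ★★ **ROW 26 (`B9.Stmt3132Printed`) AT THE `ν`-INSTANCE `opsYSectE … (opsYS349NuOfLetters … 𝔏 𝔈) 𝔏 𝔢 𝔴` OVER ANY LETTERS FAMILY `𝔏`** whose `(QGQ*)⁻¹ ∕ (QG₁Q*)⁻¹`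
fields are the ring inverses of two coarse-bond letters `S`, `S₁` (`hS ∕ hS₁` — `rfl` at every `withSectD ∕ withDE`-built record, where they are
`U ↦ Ring.inverse (Q_U G_D(U) Q*_U)`, `U ↦ Ring.inverse (Q_U G₁(U) Q*_U)`), from the four Λ-normalised Combes–Thomas binders on `S`, `S₁` —
`B9Eq3132NuReading.s3132Nu_opsYNuOfRecordV4E` letter-generic (there: `𝔏 := lettersYOfRecordV4 … 𝔯`; the instance of record `opsYNuOfRecordV4E …` IS this shape, `rfl`).
[cite: Balaban1985BackgroundPropagators, (3.132) p.422, Thm 3.12 p.423 (prefix); Balaban1984PropagatorsII, (2.142) (2.147) p.248, Prop. 2.7 (2.149) p.249] -/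
theorem s3132Nu_opsYSectE_of_ringInverse (θ : Stage3Params) (Mstar : ℕ) {c35 : ℝ}
    [∀ x : MemberY θ.d₆ θ.ℓ₆ θ.hd' θ.hL' θ.b₀ θ.b₁ Mstar, Fintype (geo9Y x).Site] [∀ x : MemberY θ.d₆ θ.ℓ₆ θ.hd' θ.hL' θ.b₀ θ.b₁ Mstar, DecidableEq (geo9Y x).Site]
    (𝔏 : LettersY N θ Mstar) (𝔈 : ExpsY N θ Mstar) (𝔢 : SectEY N θ Mstar) (𝔴 : RWEY N θ Mstar) (b : Module.Basis Ff ℝ (Matrix (Fin N) (Fin N) ℂ))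
    (S S₁ : ∀ x : MemberY θ.d₆ θ.ℓ₆ θ.hd' θ.hL' θ.b₀ θ.b₁ Mstar, CfgY (Matrix (Fin N) (Fin N) ℂ) x.toKIdx → Module.End ℂ ((geo9Y x).Site → Matrix (Fin N) (Fin N) ℂ))
    (hS : ∀ x : MemberY θ.d₆ θ.ℓ₆ θ.hd' θ.hL' θ.b₀ θ.b₁ Mstar, (𝔏 x).QGQinv = fun U => Ring.inverse (S x U))
    (hS₁ : ∀ x : MemberY θ.d₆ θ.ℓ₆ θ.hd' θ.hL' θ.b₀ θ.b₁ Mstar, (𝔏 x).QG1Qinv = fun U => Ring.inverse (S₁ x U))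
    (hco : CoerciveUnder c35 (fun x : MemberY θ.d₆ θ.ℓ₆ θ.hd' θ.hL' θ.b₀ θ.b₁ Mstar => geoComap (geo9Y x) (Prod.fst : (geo9Y x).Site × Ff → (geo9Y x).Site))
      (bg9Y (Matrix (Fin N) (Fin N) ℂ) (specialUnitaryUnits (Fin N))) (fun x U => normMatY b (lamInvY x.toKIdx) (S x U)))
    (hdec : DecayUnder c35 (fun x : MemberY θ.d₆ θ.ℓ₆ θ.hd' θ.hL' θ.b₀ θ.b₁ Mstar => geoComap (geo9Y x) (Prod.fst : (geo9Y x).Site × Ff → (geo9Y x).Site))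
      (bg9Y (Matrix (Fin N) (Fin N) ℂ) (specialUnitaryUnits (Fin N))) (fun x U => normMatY b (lamInvY x.toKIdx) (S x U)))
    (hco₁ : CoerciveUnder c35 (fun x : MemberY θ.d₆ θ.ℓ₆ θ.hd' θ.hL' θ.b₀ θ.b₁ Mstar => geoComap (geo9Y x) (Prod.fst : (geo9Y x).Site × Ff → (geo9Y x).Site))
      (bg9Y (Matrix (Fin N) (Fin N) ℂ) (specialUnitaryUnits (Fin N))) (fun x U => normMatY b (lamInvY x.toKIdx) (S₁ x U)))
    (hdec₁ : DecayUnder c35 (fun x : MemberY θ.d₆ θ.ℓ₆ θ.hd' θ.hL' θ.b₀ θ.b₁ Mstar => geoComap (geo9Y x) (Prod.fst : (geo9Y x).Site × Ff → (geo9Y x).Site))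
      (bg9Y (Matrix (Fin N) (Fin N) ℂ) (specialUnitaryUnits (Fin N))) (fun x U => normMatY b (lamInvY x.toKIdx) (S₁ x U))) :
    B9.Stmt3132Printed (θ.d₆ + 1) c35 (geo9Y (d := θ.d₆) (ℓ := θ.ℓ₆) (hd := θ.hd') (hL := θ.hL') (b₀ := θ.b₀) (b₁ := θ.b₁) (Mstar := Mstar))
      (bg9Y (Matrix (Fin N) (Fin N) ℂ) (specialUnitaryUnits (Fin N)))
      (fun x => (opsYSectE N θ Mstar (opsYS349NuOfLetters N θ Mstar 𝔏 𝔈) 𝔏 𝔢 𝔴 x).QGQinv)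
      (fun x => (opsYSectE N θ Mstar (opsYS349NuOfLetters N θ Mstar 𝔏 𝔈) 𝔏 𝔢 𝔴 x).QG1Qinv) := by
  have h0 : (fun x => (opsYSectE N θ Mstar (opsYS349NuOfLetters N θ Mstar 𝔏 𝔈) 𝔏 𝔢 𝔴 x).QGQinv) =
      fun x => siteKernelOfOpNu x.toKIdx (bg9Y (Matrix (Fin N) (Fin N) ℂ) (specialUnitaryUnits (Fin N)) x) (fun U => U) (nuY (θ.d₆ + 1) x.toKIdx)
        (fun U => Ring.inverse (S x U)) :=
    funext fun x => congrArg (siteKernelOfOpNu x.toKIdx (bg9Y (Matrix (Fin N) (Fin N) ℂ) (specialUnitaryUnits (Fin N)) x) (fun U => U)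
      (nuY (θ.d₆ + 1) x.toKIdx)) (hS x)
  have h1 : (fun x => (opsYSectE N θ Mstar (opsYS349NuOfLetters N θ Mstar 𝔏 𝔈) 𝔏 𝔢 𝔴 x).QG1Qinv) =
      fun x => siteKernelOfOpNu x.toKIdx (bg9Y (Matrix (Fin N) (Fin N) ℂ) (specialUnitaryUnits (Fin N)) x) (fun U => U) (nuY (θ.d₆ + 1) x.toKIdx)
        (fun U => Ring.inverse (S₁ x U)) :=
    funext fun x => congrArg (siteKernelOfOpNu x.toKIdx (bg9Y (Matrix (Fin N) (Fin N) ℂ) (specialUnitaryUnits (Fin N)) x) (fun U => U)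
      (nuY (θ.d₆ + 1) x.toKIdx)) (hS₁ x)
  rw [h0, h1]
  exact stmt3132Printed_nu_of_coercive_decay (specialUnitaryUnits (Fin N)) b (θ.d₆ + 1) S S₁ hco hdec hco₁ hdec₁

end NuFace

/-! ## §2 The shared binders: Sect.-D letters `T ∕ T₁ ∕ T₀`, row 20's walk model at coordinate pins naming them, its displayed inputs, row 17's `hΔA` -/

section Faces

variable (θ : Stage3Params) (Mstar : ℕ) (𝔯 : ResY N θ Mstar)
  [∀ x : MemberY θ.d₆ θ.ℓ₆ θ.hd' θ.hL' θ.b₀ θ.b₁ Mstar, Fintype (geo9Y x).Site] [∀ x : MemberY θ.d₆ θ.ℓ₆ θ.hd' θ.hL' θ.b₀ θ.b₁ Mstar, DecidableEq (geo9Y x).Site]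
  {Y Z W : MemberY θ.d₆ θ.ℓ₆ θ.hd' θ.hL' θ.b₀ θ.b₁ Mstar → Type} [∀ x, Fintype (Z x)] [∀ x, Fintype (W x)]
  (bK : Module.Basis κ ℝ (Matrix (Fin N) (Fin N) ℂ)) (b : Module.Basis Ff ℝ (Matrix (Fin N) (Fin N) ℂ)) {c35 : ℝ}
  (𝔬 : ∀ x : MemberY θ.d₆ θ.ℓ₆ θ.hd' θ.hL' θ.b₀ θ.b₁ Mstar, Ops (geo9Y x) (bg9Y (Matrix (Fin N) (Fin N) ℂ) (specialUnitaryUnits (Fin N)) x) (XBK κ x.toKIdx) (Y x) (Z x) (W x)) (H₀ : MemberY θ.d₆ θ.ℓ₆ θ.hd' θ.hL' θ.b₀ θ.b₁ Mstar → Prop)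
  -- the Sect.-D propagator letters `T = G_D(U)`, `T₁ = G₁(U)` (ANY — e.g. the composites fed the print-units site propagator) and `T₀ = G_A(U) = Δ_a(U)⁻¹`
  (T T₁ T₀ : ∀ x : MemberY θ.d₆ θ.ℓ₆ θ.hd' θ.hL' θ.b₀ θ.b₁ Mstar, BondOpY (Matrix (Fin N) (Fin N) ℂ) x.toKIdx)
  (hT₀ : ∀ (x : MemberY θ.d₆ θ.ℓ₆ θ.hd' θ.hL' θ.b₀ θ.b₁ Mstar) (U : CfgY (Matrix (Fin N) (Fin N) ℂ) x.toKIdx), T₀ x U = Ring.inverse (deltaAY x.toKIdx (parSymY x.toKIdx) (parBY x.toKIdx) (GpY x.toKIdx (parSymY x.toKIdx)) U))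
  {bI : ∀ x : MemberY θ.d₆ θ.ℓ₆ θ.hd' θ.hL' θ.b₀ θ.b₁ Mstar, FBondY x.toKIdx → IBondY x.toKIdx} (hblk : ∀ x, (𝔬 x).blk = blkBK x.toKIdx (bI x))
  (hGco : ∀ (x : MemberY θ.d₆ θ.ℓ₆ θ.hd' θ.hL' θ.b₀ θ.b₁ Mstar) (U : (bg9Y (Matrix (Fin N) (Fin N) ℂ) (specialUnitaryUnits (Fin N)) x).Cfg), (𝔬 x).G U = GcoK x.toKIdx bK (bg9Y (Matrix (Fin N) (Fin N) ℂ) (specialUnitaryUnits (Fin N)) x) (fun U => U) (T x) U)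
  (hG1co : ∀ (x : MemberY θ.d₆ θ.ℓ₆ θ.hd' θ.hL' θ.b₀ θ.b₁ Mstar) (U : (bg9Y (Matrix (Fin N) (Fin N) ℂ) (specialUnitaryUnits (Fin N)) x).Cfg), (𝔬 x).G1 U = GcoK x.toKIdx bK (bg9Y (Matrix (Fin N) (Fin N) ℂ) (specialUnitaryUnits (Fin N)) x) (fun U => U) (T₁ x) U)
  (hG0co : ∀ (x : MemberY θ.d₆ θ.ℓ₆ θ.hd' θ.hL' θ.b₀ θ.b₁ Mstar) (U : (bg9Y (Matrix (Fin N) (Fin N) ℂ) (specialUnitaryUnits (Fin N)) x).Cfg), (𝔬 x).G0 U = GcoK x.toKIdx bK (bg9Y (Matrix (Fin N) (Fin N) ℂ) (specialUnitaryUnits (Fin N)) x) (fun U => U) (T₀ x) U)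
  (hlev : ∀ (x : MemberY θ.d₆ θ.ℓ₆ θ.hd' θ.hL' θ.b₀ θ.b₁ Mstar) (f : FBondY x.toKIdx), lvl x.hN x.D x.hk (bI x f) = (blkV1 x.hN x.D f).1.1)
  (hβ1 : ∀ (x : MemberY θ.d₆ θ.ℓ₆ θ.hd' θ.hL' θ.b₀ θ.b₁ Mstar) (f : FBondY x.toKIdx), (B6Geom246MultiLevelTorus.geomT x.D).dist (β x.hN x.D x.hk (bI x f)) (blkV1 x.hN x.D f) ≤ 1)
  {mN : ℕ} (hnbr : ∀ (x : MemberY θ.d₆ θ.ℓ₆ θ.hd' θ.hL' θ.b₀ θ.b₁ Mstar) (y : (geo9Y x).Site), (nbr (geo9Y x) ((θ.ℓ₆ : ℝ) + 4) y).card ≤ mN)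
  {R : MemberY θ.d₆ θ.ℓ₆ θ.hd' θ.hL' θ.b₀ θ.b₁ Mstar → ℝ} {H : MemberY θ.d₆ θ.ℓ₆ θ.hd' θ.hL' θ.b₀ θ.b₁ Mstar → Prop}
  (θ₁ r₁ B₀ δ₀ δK σ ρ a₁ M₁ : ℝ) (hθ₁ : 0 ≤ θ₁) (hB₀ : 0 ≤ B₀) (hσ : 0 < σ) (hρ : 0 < ρ) (hρS : ρ ≤ δ₀) (hρδ : ρ + σ ≤ δK)
  (ha₁ : 0 < a₁) (hM₁ : 0 < M₁) (hgeo : ∀ x : MemberY θ.d₆ θ.ℓ₆ θ.hd' θ.hL' θ.b₀ θ.b₁ Mstar, GeoOK (geo9Y x))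
  (hmodel : ∀ x : MemberY θ.d₆ θ.ℓ₆ θ.hd' θ.hL' θ.b₀ θ.b₁ Mstar, M₁ ≤ (geo9Y x).M → ∀ α₀ : ℝ, 0 < α₀ → (geo9Y x).M * α₀ ≤ a₁ → ∀ U : (bg9Y (Matrix (Fin N) (Fin N) ℂ) (specialUnitaryUnits (Fin N)) x).Cfg,
    (bg9Y (Matrix (Fin N) (Fin N) ℂ) (specialUnitaryUnits (Fin N)) x).Reg335 c35 α₀ U → (bg9Y (Matrix (Fin N) (Fin N) ℂ) (specialUnitaryUnits (Fin N)) x).Reg336 c35 α₀ U →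
      Thm33G0 (𝔬 x) 1 (H₀ x) B₀ δ₀ U ∧ Step (𝔬 x) 1 (H₀ x) (hgeo x).lenle 1 (θ₁ * ((geo9Y x).M * α₀)) δK U ∧
        Step (𝔬 x) 1 (H₀ x) (hgeo x).lenle 2 (θ₁ * ((geo9Y x).M * α₀)) δK U ∧ FormSmall (𝔬 x) (r₁ * ((geo9Y x).M * α₀)) U ∧ Identities (𝔬 x) U)
  (a311 M311 : ℝ) (ha311 : 0 < a311) (hM311 : 0 < M311)
  (hΔA : ∀ x : MemberY θ.d₆ θ.ℓ₆ θ.hd' θ.hL' θ.b₀ θ.b₁ Mstar, M311 ≤ (geo9Y x).M → ∀ α₀ : ℝ, 0 < α₀ → (geo9Y x).M * α₀ ≤ a311 → ∀ U : (bg9Y (Matrix (Fin N) (Fin N) ℂ) (specialUnitaryUnits (Fin N)) x).Cfg, (bg9Y (Matrix (Fin N) (Fin N) ℂ) (specialUnitaryUnits (Fin N)) x).Reg335 c35 α₀ U →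
    PosDefTr (fun _ => (1 : ℝ)) (deltaAY x.toKIdx (parSymY x.toKIdx) (parBY x.toKIdx) (GpY x.toKIdx (parSymY x.toKIdx)) U))
  (hP1 : ∃ Mt aT C : ℝ, 0 < Mt ∧ 0 < aT ∧ 0 < C ∧ ∀ x : MemberY θ.d₆ θ.ℓ₆ θ.hd' θ.hL' θ.b₀ θ.b₁ Mstar, Mt ≤ (geo9Y x).M → ∀ α₀ : ℝ, 0 < α₀ → (geo9Y x).M * α₀ ≤ aT →
    ∀ U : (bg9Y (Matrix (Fin N) (Fin N) ℂ) (specialUnitaryUnits (Fin N)) x).Cfg, (bg9Y (Matrix (Fin N) (Fin N) ℂ) (specialUnitaryUnits (Fin N)) x).Reg335 c35 α₀ U → (bg9Y (Matrix (Fin N) (Fin N) ℂ) (specialUnitaryUnits (Fin N)) x).Reg336 c35 α₀ U → ∀ Ψ : IBondY x.toKIdx → Matrix (Fin N) (Fin N) ℂ,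
      trIP (fun _ => (1 : ℝ)) (tentOp x.toKIdx (bumpProfile x.toKIdx) U Ψ)
          (deltaAY x.toKIdx (parSymY x.toKIdx) (parBY x.toKIdx) (GpY x.toKIdx (parSymY x.toKIdx)) U (tentOp x.toKIdx (bumpProfile x.toKIdx) U Ψ)) ≤
        C * trIP (fun _ => (1 : ℝ)) Ψ Ψ)

/-! ## §3 ★ ROW 26's TWO DECAY BINDERS FOR ARBITRARY SECT.-D LETTERS `T = G_D`, `T₁ = G₁` -/

include hlev hβ1 hnbr in
/-- ★ **THE DECAY BINDERS FOR `(Q T(U) Q*)` AND `(Q T₁(U) Q*)` FROM THE [4]-(2.51) MAJORANTS OF THEIR COORDINATE MODELS** under Theorem 3.12's prefix (faithful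
`bI`, radius-`(ℓ+4)` count; the bond transporters `parBY` are `SU(N)`-valued on (3.35) configurations, hence contractive) — `B9Eq3132DecayFromMajorant.hdec26_of_majorants`
for ARBITRARY bond-sector letters `T`, `T₁` (there: `T := fun x => (lettersYOfRecordV4 … x).GD`, `T₁ := (…).G₁`).
[cite: Balaban1985BackgroundPropagators, (3.132) p.422, Thm 3.12 p.423 (prefix); Balaban1984PropagatorsII, (2.142) p.248, (2.149) p.249, Lemma 2.1 (2.60) p.234] -/
theorem hdec26_of_majorants_of
    (h : ∃ M₂ a₂ C δ : ℝ, 0 < M₂ ∧ 0 < a₂ ∧ 0 ≤ C ∧ 0 < δ ∧ ∀ x : MemberY θ.d₆ θ.ℓ₆ θ.hd' θ.hL' θ.b₀ θ.b₁ Mstar, M₂ ≤ (geo9Y x).M → ∀ α₀ : ℝ, 0 < α₀ → (geo9Y x).M * α₀ ≤ a₂ →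
      ∀ U : (bg9Y (Matrix (Fin N) (Fin N) ℂ) (specialUnitaryUnits (Fin N)) x).Cfg, (bg9Y (Matrix (Fin N) (Fin N) ℂ) (specialUnitaryUnits (Fin N)) x).Reg335 c35 α₀ U → (bg9Y (Matrix (Fin N) (Fin N) ℂ) (specialUnitaryUnits (Fin N)) x).Reg336 c35 α₀ U →
        HasMajorant (g := toB6 (geo9Y x) (R x) (H x)) (blkBK x.toKIdx (bI x)) (GcoK x.toKIdx bK (bg9Y (Matrix (Fin N) (Fin N) ℂ) (specialUnitaryUnits (Fin N)) x) (fun U => U) (T x) U)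
            (fun a a' => C * (geo9Y x).len a ^ 2 * Real.exp (-(δ * (geo9Y x).dist a a'))) ∧
          HasMajorant (g := toB6 (geo9Y x) (R x) (H x)) (blkBK x.toKIdx (bI x)) (GcoK x.toKIdx bK (bg9Y (Matrix (Fin N) (Fin N) ℂ) (specialUnitaryUnits (Fin N)) x) (fun U => U) (T₁ x) U)
            (fun a a' => C * (geo9Y x).len a ^ 2 * Real.exp (-(δ * (geo9Y x).dist a a')))) :
    DecayUnder c35 (fun x : MemberY θ.d₆ θ.ℓ₆ θ.hd' θ.hL' θ.b₀ θ.b₁ Mstar => geoComap (geo9Y x) (Prod.fst : (geo9Y x).Site × Ff → (geo9Y x).Site))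
        (bg9Y (Matrix (Fin N) (Fin N) ℂ) (specialUnitaryUnits (Fin N))) (fun x U => normMatY b (lamInvY x.toKIdx) (QGQOfY x.toKIdx (parBY x.toKIdx) (T x) U)) ∧
      DecayUnder c35 (fun x : MemberY θ.d₆ θ.ℓ₆ θ.hd' θ.hL' θ.b₀ θ.b₁ Mstar => geoComap (geo9Y x) (Prod.fst : (geo9Y x).Site × Ff → (geo9Y x).Site))
        (bg9Y (Matrix (Fin N) (Fin N) ℂ) (specialUnitaryUnits (Fin N))) (fun x U => normMatY b (lamInvY x.toKIdx) (QGQOfY x.toKIdx (parBY x.toKIdx) (T₁ x) U)) := by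
  obtain ⟨M₂, a₂, C, δ, hM₂, ha₂, hC, hδ, hmaj⟩ := h
  have hparG : ∀ (x : MemberY θ.d₆ θ.ℓ₆ θ.hd' θ.hL' θ.b₀ θ.b₁ Mstar) (U : CfgY (Matrix (Fin N) (Fin N) ℂ) x.toKIdx), (∀ μ y, U μ y ∈ specialUnitaryUnits (Fin N)) →
      ∀ s s', ‖(parBY x.toKIdx U s s' : Matrix (Fin N) (Fin N) ℂ)‖ ≤ 1 ∧ ‖(((parBY x.toKIdx U s s')⁻¹ : (Matrix (Fin N) (Fin N) ℂ)ˣ) : Matrix (Fin N) (Fin N) ℂ)‖ ≤ 1 :=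
    fun x U hUG s s' => contractive_of_mem specialUnitaryUnits_le_unitaryUnits (parBY_mem x.toKIdx hUG s s')
  exact ⟨decayUnder_QGQOfY_of_majorants (G := specialUnitaryUnits (Fin N)) bK b T (fun x => parBY x.toKIdx) hparG hlev hβ1 hnbr
      ⟨M₂, a₂, C, δ, hM₂, ha₂, hC, hδ, fun x hM α₀ hα₀ hMa U hU hU' => (hmaj x hM α₀ hα₀ hMa U hU hU').1⟩,
    decayUnder_QGQOfY_of_majorants (G := specialUnitaryUnits (Fin N)) bK b T₁ (fun x => parBY x.toKIdx) hparG hlev hβ1 hnbr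
      ⟨M₂, a₂, C, δ, hM₂, ha₂, hC, hδ, fun x hM α₀ hα₀ hMa U hU hU' => (hmaj x hM α₀ hα₀ hMa U hU hU').2⟩⟩

include hblk hGco hG1co hlev hβ1 hnbr hθ₁ hB₀ hσ hρ hρS hρδ ha₁ hM₁ hmodel in
/-- ★ **ROW 26's TWO DECAY BINDERS FROM ROW 20's DISPLAYED INPUTS, FOR ARBITRARY SECT.-D LETTERS** — the certificate's `hmodel12` conjuncts (Theorem 3.3 for
`G₀`, the (3.131)∕(3.137) steps, `FormSmall`, the Sect.-D identities) at coordinate pins `blk = blkBK bI`, `G U = GcoK … (T x) U`, `G1 U = GcoK … (T₁ x) U`,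
the static geometry `GeoOK`, the faithful block map (`hlev`, `hβ1`) and a radius-`(ℓ+4)` neighbour count give `DecayUnder` for the Λ-normalised
`Q T(U) Q*` and `Q T₁(U) Q*` — `B9Eq3132DecayFromMajorant.hdec26_of_step12` with the v4 record's `G_D ∕ G₁` replaced by letters `T ∕ T₁` (so it serves Sect.-D
pins at the print-units site propagator).  Honest: row 20's inputs stay displayed hypotheses of printed shape; count-neutral bookkeeping.
[cite: Balaban1985BackgroundPropagators, (3.132) p.422, Thm 3.12 pp.421–423, (3.130)–(3.131), (3.137)–(3.138); Balaban1984PropagatorsII, (2.142) p.248, (2.51) p.232, Lemma 2.1 (2.60)–(2.61) p.234] -/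
theorem hdec26_of_step12_of :
    DecayUnder c35 (fun x : MemberY θ.d₆ θ.ℓ₆ θ.hd' θ.hL' θ.b₀ θ.b₁ Mstar => geoComap (geo9Y x) (Prod.fst : (geo9Y x).Site × Ff → (geo9Y x).Site))
        (bg9Y (Matrix (Fin N) (Fin N) ℂ) (specialUnitaryUnits (Fin N))) (fun x U => normMatY b (lamInvY x.toKIdx) (QGQOfY x.toKIdx (parBY x.toKIdx) (T x) U)) ∧
      DecayUnder c35 (fun x : MemberY θ.d₆ θ.ℓ₆ θ.hd' θ.hL' θ.b₀ θ.b₁ Mstar => geoComap (geo9Y x) (Prod.fst : (geo9Y x).Site × Ff → (geo9Y x).Site))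
        (bg9Y (Matrix (Fin N) (Fin N) ℂ) (specialUnitaryUnits (Fin N))) (fun x U => normMatY b (lamInvY x.toKIdx) (QGQOfY x.toKIdx (parBY x.toKIdx) (T₁ x) U)) :=
  hdec26_of_majorants_of θ Mstar bK b T T₁ hlev hβ1 hnbr (R := fun _ => 1)
    (majorants_of_step12 (G := specialUnitaryUnits (Fin N)) bK 𝔬 H₀ T T₁ hblk hGco hG1co θ₁ r₁ B₀ δ₀ δK σ ρ a₁ M₁ hθ₁ hB₀ hσ hρ hρS hρδ ha₁ hM₁
      hgeo hmodel)

/-! ## §4 ★★ ROW 26's TWO COERCIVITY BINDERS FOR ARBITRARY SECT.-D LETTERS, FROM ONE FOR `T₀` — AND THAT ONE FROM ROW 17 + THE TENT ENERGY -/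

include hblk hGco hG1co hG0co hlev hβ1 hnbr hθ₁ hB₀ hσ hρ hρS hρδ ha₁ hM₁ hmodel in
/-- ★ **THE COERCIVITY BINDERS FOR `(Q T(U) Q*)` AND `(Q T₁(U) Q*)` FROM ONE FOR `(Q T₀(U) Q*)` AND ROW 20's DISPLAYED INPUTS** — the certificate's `hmodel12`
conjuncts at coordinate pins naming `T` (`G`), `T₁` (`G1`), `T₀` (`G0`), the static geometry, the faithful block map, a radius-`(ℓ+4)` count and `hcoA` =
Λ²-coercivity of the normalised `Q T₀(U) Q*` ([4] (2.147) transported to `U`): `B9Eq3132CoerciveFromGA.hco26_of_hcoA_step12` with the v4 record's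
`G_D ∕ G₁ ∕ G_A` replaced by letters `T ∕ T₁ ∕ T₀`.  Honest: `hcoA` and row 20's inputs stay displayed hypotheses; count-neutral bookkeeping.
[cite: Balaban1985BackgroundPropagators, (3.132) p.422, Thm 3.12 pp.421–423, (3.130)–(3.131), (3.137)–(3.138); Balaban1984PropagatorsII, (2.147) p.249, (2.142) p.248, (2.51) p.232, Lemma 2.1 (2.60)–(2.61) p.234] -/
theorem hco26_of_hcoA_step12_of
    (hcoA : CoerciveUnder c35 (fun x : MemberY θ.d₆ θ.ℓ₆ θ.hd' θ.hL' θ.b₀ θ.b₁ Mstar => geoComap (geo9Y x) (Prod.fst : (geo9Y x).Site × Ff → (geo9Y x).Site))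
      (bg9Y (Matrix (Fin N) (Fin N) ℂ) (specialUnitaryUnits (Fin N))) (fun x U => normMatY b (lamInvY x.toKIdx) (QGQOfY x.toKIdx (parBY x.toKIdx) (T₀ x) U))) :
    CoerciveUnder c35 (fun x : MemberY θ.d₆ θ.ℓ₆ θ.hd' θ.hL' θ.b₀ θ.b₁ Mstar => geoComap (geo9Y x) (Prod.fst : (geo9Y x).Site × Ff → (geo9Y x).Site))
        (bg9Y (Matrix (Fin N) (Fin N) ℂ) (specialUnitaryUnits (Fin N))) (fun x U => normMatY b (lamInvY x.toKIdx) (QGQOfY x.toKIdx (parBY x.toKIdx) (T x) U)) ∧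
      CoerciveUnder c35 (fun x : MemberY θ.d₆ θ.ℓ₆ θ.hd' θ.hL' θ.b₀ θ.b₁ Mstar => geoComap (geo9Y x) (Prod.fst : (geo9Y x).Site × Ff → (geo9Y x).Site))
        (bg9Y (Matrix (Fin N) (Fin N) ℂ) (specialUnitaryUnits (Fin N))) (fun x U => normMatY b (lamInvY x.toKIdx) (QGQOfY x.toKIdx (parBY x.toKIdx) (T₁ x) U)) := by
  have hparG : ∀ (x : MemberY θ.d₆ θ.ℓ₆ θ.hd' θ.hL' θ.b₀ θ.b₁ Mstar) (U : CfgY (Matrix (Fin N) (Fin N) ℂ) x.toKIdx), (∀ μ y, U μ y ∈ specialUnitaryUnits (Fin N)) →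
      ∀ s s', ‖(parBY x.toKIdx U s s' : Matrix (Fin N) (Fin N) ℂ)‖ ≤ 1 ∧ ‖(((parBY x.toKIdx U s s')⁻¹ : (Matrix (Fin N) (Fin N) ℂ)ˣ) : Matrix (Fin N) (Fin N) ℂ)‖ ≤ 1 :=
    fun x U hUG s s' => contractive_of_mem specialUnitaryUnits_le_unitaryUnits (parBY_mem x.toKIdx hUG s s')
  obtain ⟨M₂, a₂, C, δ, hM₂, ha₂, hC, hδ, hmaj⟩ := subMajorants_of_step12 (G := specialUnitaryUnits (Fin N)) bK 𝔬 H₀ T T₁ T₀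
    hblk hGco hG1co hG0co θ₁ r₁ B₀ δ₀ δK σ ρ a₁ M₁ hθ₁ hB₀ hσ hρ hρS hρδ ha₁ hM₁ hgeo hmodel
  exact ⟨coerciveUnder_of_subMajorants (G := specialUnitaryUnits (Fin N)) bK b T T₀ (fun x => parBY x.toKIdx) hparG hlev hβ1 hnbr (R := fun _ => 1) hcoA
      ⟨M₂, a₂, C, δ, hM₂, ha₂, hC, hδ, fun x hM α₀ hα₀ hMa U hU hU' => (hmaj x hM α₀ hα₀ hMa U hU hU').1⟩,
    coerciveUnder_of_subMajorants (G := specialUnitaryUnits (Fin N)) bK b T₁ T₀ (fun x => parBY x.toKIdx) hparG hlev hβ1 hnbr (R := fun _ => 1) hcoA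
      ⟨M₂, a₂, C, δ, hM₂, ha₂, hC, hδ, fun x hM α₀ hα₀ hMa U hU hU' => (hmaj x hM α₀ hα₀ hMa U hU hU').2⟩⟩

include 𝔯 hT₀ ha311 hM311 hΔA hP1 in
/-- ★ **`hcoA` FOR ANY LETTER `T₀` THAT IS `Δ_a(U)⁻¹`** (`T₀ x U = Ring.inverse (deltaAY … U)` — `rfl` at the `.GA` field of every record since v2): the
coercivity of the Λ-normalised `Q(U) T₀(U) Q*(U)` at the basis `trBasis N` from row 17's displayed `hΔA` and the energy bound (P′1) `hP1` of the transported
tent bumps — `B9Eq3132CoerciveFromEnergy.hcoA_of_energy` re-addressed from `(lettersYOfRecordV4 … 𝔯 x).GA` (any residual family `𝔯`; only the record's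
unit-safe Sect. A–C field is read, which stays on `GpY`) to `T₀`. [cite: Balaban1984PropagatorsII, (2.147) p.248; Balaban1985BackgroundPropagators, (3.132) p.422, Thm 3.11 p.416, (3.27) p.395] -/
theorem hcoA_of_energy_of :
    CoerciveUnder c35 (fun x : MemberY θ.d₆ θ.ℓ₆ θ.hd' θ.hL' θ.b₀ θ.b₁ Mstar => geoComap (geo9Y x) (Prod.fst : (geo9Y x).Site × TrIdx N → (geo9Y x).Site))
      (bg9Y (Matrix (Fin N) (Fin N) ℂ) (specialUnitaryUnits (Fin N))) (fun x U => normMatY (trBasis N) (lamInvY x.toKIdx) (QGQOfY x.toKIdx (parBY x.toKIdx) (T₀ x) U)) := by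
  have hT : T₀ = fun x => (lettersYOfRecordV4 N θ Mstar 𝔯 x).GA := funext fun x => funext fun U => by rw [hT₀ x U]; rfl
  subst hT
  exact hcoA_of_energy θ Mstar 𝔯 a311 M311 ha311 hM311 hΔA hP1

include 𝔯 hT₀ hblk hGco hG1co hG0co hlev hβ1 hnbr hθ₁ hB₀ hσ hρ hρS hρδ ha₁ hM₁ hmodel ha311 hM311 hΔA hP1 in
/-- ★★ **ROW 26's TWO COERCIVITY BINDERS FOR ARBITRARY SECT.-D LETTERS FROM ROW 17 AND ONE ENERGY ESTIMATE**: at the basis `trBasis N`, family index `TrIdx N`,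
from row 17's displayed `hΔA`, the energy bound (P′1) `hP1` of the transported tent bumps, and row 20's step schema at pins naming `T ∕ T₁ ∕ T₀` with
`T₀ = Δ_a⁻¹` (`hT₀`) — `B9Eq3132CoerciveFromEnergy.hco26_of_energy_step12` letter-generic.
[cite: Balaban1985BackgroundPropagators, (3.132) p.422, Thm 3.12 pp.421–423, Thm 3.11 p.416; Balaban1984PropagatorsII, (2.147) p.248] -/
theorem hco26_of_energy_step12_of :
    CoerciveUnder c35 (fun x : MemberY θ.d₆ θ.ℓ₆ θ.hd' θ.hL' θ.b₀ θ.b₁ Mstar => geoComap (geo9Y x) (Prod.fst : (geo9Y x).Site × TrIdx N → (geo9Y x).Site))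
        (bg9Y (Matrix (Fin N) (Fin N) ℂ) (specialUnitaryUnits (Fin N))) (fun x U => normMatY (trBasis N) (lamInvY x.toKIdx) (QGQOfY x.toKIdx (parBY x.toKIdx) (T x) U)) ∧
      CoerciveUnder c35 (fun x : MemberY θ.d₆ θ.ℓ₆ θ.hd' θ.hL' θ.b₀ θ.b₁ Mstar => geoComap (geo9Y x) (Prod.fst : (geo9Y x).Site × TrIdx N → (geo9Y x).Site))
        (bg9Y (Matrix (Fin N) (Fin N) ℂ) (specialUnitaryUnits (Fin N))) (fun x U => normMatY (trBasis N) (lamInvY x.toKIdx) (QGQOfY x.toKIdx (parBY x.toKIdx) (T₁ x) U)) :=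
  hco26_of_hcoA_step12_of θ Mstar bK (trBasis N) 𝔬 H₀ T T₁ T₀ hblk hGco hG1co hG0co hlev hβ1 hnbr θ₁ r₁ B₀ δ₀ δK σ ρ a₁ M₁ hθ₁ hB₀ hσ hρ hρS hρδ
    ha₁ hM₁ hgeo hmodel (hcoA_of_energy_of θ Mstar 𝔯 T₀ hT₀ a311 M311 ha311 hM311 hΔA hP1)

include 𝔯 hT₀ hblk hGco hG1co hG0co hlev hβ1 hnbr hθ₁ hB₀ hσ hρ hρS hρδ ha₁ hM₁ hmodel ha311 hM311 hΔA in
/-- ★★ **ROW 26's TWO COERCIVITY BINDERS FOR ARBITRARY SECT.-D LETTERS FROM ROW 17 ALONE** (besides row 20's inputs): `hco26_of_energy_step12_of` with the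
energy bound `hP1` DISCHARGED by `B9Eq3132TentLassos.hP1_of_reg335` (dag-n06-i gen 14: the Δ_a(U)-energy of the transported tent bumps under (3.35), no
hypothesis).  Displays for row 26: row 17's `hΔA` (Theorem 3.11's positivity of `Δ_a(U)`), nothing of its own.
[cite: Balaban1985BackgroundPropagators, (3.132) p.422, Thm 3.12 pp.421–423, Thm 3.11 p.416; Balaban1984PropagatorsII, (2.147) p.248] -/
theorem hco26_of_reg335_step12_of :
    CoerciveUnder c35 (fun x : MemberY θ.d₆ θ.ℓ₆ θ.hd' θ.hL' θ.b₀ θ.b₁ Mstar => geoComap (geo9Y x) (Prod.fst : (geo9Y x).Site × TrIdx N → (geo9Y x).Site))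
        (bg9Y (Matrix (Fin N) (Fin N) ℂ) (specialUnitaryUnits (Fin N))) (fun x U => normMatY (trBasis N) (lamInvY x.toKIdx) (QGQOfY x.toKIdx (parBY x.toKIdx) (T x) U)) ∧
      CoerciveUnder c35 (fun x : MemberY θ.d₆ θ.ℓ₆ θ.hd' θ.hL' θ.b₀ θ.b₁ Mstar => geoComap (geo9Y x) (Prod.fst : (geo9Y x).Site × TrIdx N → (geo9Y x).Site))
        (bg9Y (Matrix (Fin N) (Fin N) ℂ) (specialUnitaryUnits (Fin N))) (fun x U => normMatY (trBasis N) (lamInvY x.toKIdx) (QGQOfY x.toKIdx (parBY x.toKIdx) (T₁ x) U)) :=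
  hco26_of_energy_step12_of θ Mstar 𝔯 bK 𝔬 H₀ T T₁ T₀ hT₀ hblk hGco hG1co hG0co hlev hβ1 hnbr θ₁ r₁ B₀ δ₀ δK σ ρ a₁ M₁ hθ₁ hB₀ hσ hρ hρS hρδ ha₁ hM₁
    hgeo hmodel a311 M311 ha311 hM311 hΔA (hP1_of_reg335 θ Mstar c35)

/-! ## §5 ★★★ ROW 26 CLOSED AT THE `ν`-INSTANCE OVER A LETTERS FAMILY, FROM ROW 20's INPUTS AND ROW 17's `hΔA` — ONE CALL FOR THE KNIT -/

include 𝔯 hT₀ hblk hGco hG1co hG0co hlev hβ1 hnbr hθ₁ hB₀ hσ hρ hρS hρδ ha₁ hM₁ hmodel ha311 hM311 hΔA in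
/-- ★★★ **ROW 26 AT THE `ν`-INSTANCE OVER A LETTERS FAMILY `𝔏`, FROM ROW 20's DISPLAYED INPUTS AND ROW 17's `hΔA` ALONE** (§3 + §4 + §1): for ANY `𝔏` whose
`(QGQ*)⁻¹ ∕ (QG₁Q*)⁻¹` fields are `U ↦ Ring.inverse (Q_U T(U) Q*_U)`, `U ↦ Ring.inverse (Q_U T₁(U) Q*_U)` (`hQ ∕ hQ₁` — `rfl` at every `withSectD ∕ withDE`-built
record with `T := fun x => (𝔏 x).GD`, `T₁ := fun x => (𝔏 x).G₁`) and whose walk model is pinned at `T ∕ T₁ ∕ T₀ = Δ_a⁻¹` (`hT₀`, `rfl` at `.GA`),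
`B9.Stmt3132Printed` ((3.132), both kernels) holds at the certificate's instance shape `opsYSectE … (opsYS349NuOfLetters … 𝔏 𝔈) 𝔏 𝔢 𝔴` (basis `trBasis N`).
What row 26 then displays of its own: NOTHING (row 17's `hΔA` and row 20's inputs are those rows' displays).  Honest: count-neutral bookkeeping; NOT a
node discharge. [cite: Balaban1985BackgroundPropagators, (3.132) p.422, Thm 3.12 pp.421–423, Thm 3.11 p.416; Balaban1984PropagatorsII, (2.142) (2.147) p.248, Prop. 2.7 (2.149) p.249] -/
theorem s3132Nu_opsYSectE_of_step12 (𝔏 : LettersY N θ Mstar) (𝔈 : ExpsY N θ Mstar) (𝔢 : SectEY N θ Mstar) (𝔴 : RWEY N θ Mstar)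
    (hQ : ∀ x : MemberY θ.d₆ θ.ℓ₆ θ.hd' θ.hL' θ.b₀ θ.b₁ Mstar, (𝔏 x).QGQinv = fun U => Ring.inverse (QGQOfY x.toKIdx (parBY x.toKIdx) (T x) U))
    (hQ₁ : ∀ x : MemberY θ.d₆ θ.ℓ₆ θ.hd' θ.hL' θ.b₀ θ.b₁ Mstar, (𝔏 x).QG1Qinv = fun U => Ring.inverse (QGQOfY x.toKIdx (parBY x.toKIdx) (T₁ x) U)) :
    B9.Stmt3132Printed (θ.d₆ + 1) c35 (geo9Y (d := θ.d₆) (ℓ := θ.ℓ₆) (hd := θ.hd') (hL := θ.hL') (b₀ := θ.b₀) (b₁ := θ.b₁) (Mstar := Mstar))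
      (bg9Y (Matrix (Fin N) (Fin N) ℂ) (specialUnitaryUnits (Fin N)))
      (fun x => (opsYSectE N θ Mstar (opsYS349NuOfLetters N θ Mstar 𝔏 𝔈) 𝔏 𝔢 𝔴 x).QGQinv)
      (fun x => (opsYSectE N θ Mstar (opsYS349NuOfLetters N θ Mstar 𝔏 𝔈) 𝔏 𝔢 𝔴 x).QG1Qinv) := by
  obtain ⟨hdec, hdec₁⟩ := hdec26_of_step12_of θ Mstar bK (trBasis N) 𝔬 H₀ T T₁ hblk hGco hG1co hlev hβ1 hnbr θ₁ r₁ B₀ δ₀ δK σ ρ a₁ M₁ hθ₁ hB₀ hσ hρ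
    hρS hρδ ha₁ hM₁ hgeo hmodel
  obtain ⟨hco, hco₁⟩ := hco26_of_reg335_step12_of θ Mstar 𝔯 bK 𝔬 H₀ T T₁ T₀ hT₀ hblk hGco hG1co hG0co hlev hβ1 hnbr θ₁ r₁ B₀ δ₀ δK σ ρ a₁ M₁ hθ₁ hB₀
    hσ hρ hρS hρδ ha₁ hM₁ hgeo hmodel a311 M311 ha311 hM311 hΔA
  exact s3132Nu_opsYSectE_of_ringInverse θ Mstar 𝔏 𝔈 𝔢 𝔴 (trBasis N) (fun x U => QGQOfY x.toKIdx (parBY x.toKIdx) (T x) U)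
    (fun x U => QGQOfY x.toKIdx (parBY x.toKIdx) (T₁ x) U) hQ hQ₁ hco hdec hco₁ hdec₁

end Faces

end Literature.MathematicalPhysics.QuantumFieldTheory.Balaban1983to89.B9Eq3132FacesAtLetters

end
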